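import Literature.NumberTheory.GaloisRepresentations.IdeleTruncatedSLocalInjectivity
import Literature.NumberTheory.GaloisCohomology.ArchimedeanInvariantMap
import Literature.Algebra.Homology.DiscreteRepExtInternalHomGalois
import Literature.Algebra.Homology.DiscreteRepCoinduced
import HarnessLib

/-!
# The archimedean components of the `S`-idèle localisation map vanish in positive degree for a totally
# complex base field (`Γ_{K_w} = Gal(ℂ/ℂ)` trivial, `K̄_wˣ` divisible): the input `harch0` of the (Λ1)–(Λ2) bridge

Topic `NumberTheory/GaloisRepresentations`; namespace `Literature.NumberTheory.GaloisRepresentations.IdeleReadout`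
(the arithmetic statements) and `Literature.Algebra.Homology.DiscreteRep` (one generic lemma).  One definition with
body (`DiscreteRep.isoCoindOfForallEqOne`, the tautological isomorphism `M ≅ CoInd(M)` over a TRIVIAL group) and
theorems; NO named fact, no `sorry`, no instance, no notation; number fields in `Type`.

THE POINT (lane «PT-Ш-S-TC» of crux `GoodLatticeBDPValue`, stmt-BirchSwinnertonDyer-19032, cell bsd-eis; bsd-eis
-w7 g13's bridge `hΛ2_lambdaLoc_of_idLocMap_injective … (harch0 : ∀ z (u : InfinitePlace K), IdeleReadout.idLocMap K S _
2 z ⟨Sum.inl u, trivial⟩ = 0)`; -w4 g20's memo `LAMBDA-E-DEVISSAGE-w4g20-v2.md` §3 «the arch components vanish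
identically when `Ext²_{C_{Γ_{K_w}}}(φ_w^*A, ℂˣ) = 0` (K totally complex: `Γ_ℂ` trivial)»).  For `K` totally complex
every infinite place `u` is complex, so `Γ_{K_u} = Gal(ℂ/ℂ)` is trivial
(`GaloisCohomology.eq_one_absoluteGaloisGroup_of_isComplex`); over a trivial (compact) group every object `M` of
`C_Γ` IS the co-induced module `CoInd(M) = LocallyConstant Γ M` (§1), and `Ext^{q+1}_{C_Γ}(N, CoInd V) = 0` for `V`
an injective `ℤ`-module (door-c4 `ext_eq_zero_of_iso_coind_of_injective`); `K̄_uˣ` is divisible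
(`divisibleByUnitsCarrier`), hence injective over `ℤ` (`injective_moduleCat_int_of_divisibleBy`).  So
`Ext^{q+1}_{C_{Γ_{K_u}}}(N, K̄_uˣ) = 0` for every `N` (§2), and every archimedean component of `idLocMap K S A (q+1)`
vanishes (§3, **`idLocMap_succ_inl_eq_zero`**; `harch0` = the case `q + 1 = 2`, **`idLocMap_two_inl_eq_zero`**).

HONEST FRAMING: elementary bookkeeping (a 2-line mathematical remark); no case of Poitou–Tate duality and nothing
about BSD is proved here.  AI formalisation, established only by the kernel check.

## References
* J.-P. Serre, *Galois Cohomology* (1997), I §2.5 (induced modules are acyclic), II §1.1 (`K̄ˣ` divisible),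
  II §6.3 (archimedean places). [SerreGaloisCohomology1997]
* J. S. Milne, *Arithmetic Duality Theorems*, 2nd ed. (2006), I §0 Example 0.8, I Thm. 4.10 (a) (the archimedean
  factors for totally complex `K`), I Lemma 4.13. [MilneADT2006]
-/

noncomputable section

universe u

/-! ## §1 Over a trivial group every discrete module is co-induced -/

namespace Literature.Algebra.Homology

namespace DiscreteRep

open CategoryTheory CategoryTheory.Limits CategoryTheory.Abelian

variable {k Γ : Type u} [CommRing k] [Group Γ] [TopologicalSpace Γ] [IsTopologicalGroup Γ] [CompactSpace Γ]

/-- **Over a TRIVIAL group, `M ≅ CoInd(M)`**: `a ↦ (x ↦ ρ(x⁻¹) a)` (Frobenius lift of the identity) with inverse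
`f ↦ f 1`. [cite: SerreGaloisCohomology1997, I §2.5] -/
def isoCoindOfForallEqOne (hΓ : ∀ g : Γ, g = 1) (M : DiscreteRepCat k Γ) : M ≅ coind k Γ M.obj.V where
  hom := coindLift M LinearMap.id
  inv := ObjectProperty.homMk (Rep.ofHom
    ⟨LocallyConstant.evalₗ k (1 : Γ),
     fun g => LinearMap.ext fun f => by
       rw [hΓ g, map_one, map_one]
       rfl⟩)
  hom_inv_id := ObjectProperty.hom_ext _ (Rep.hom_ext (DFunLike.ext _ _ fun a => by
    change (coindLift M LinearMap.id).hom.hom a 1 = a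
    rw [coindLift_apply_apply, inv_one, map_one]
    rfl))
  inv_hom_id := ObjectProperty.hom_ext _ (Rep.hom_ext (DFunLike.ext _ _ fun f =>
    LocallyConstant.ext fun x => by
      change (coindLift M LinearMap.id).hom.hom (f 1) x = f x
      rw [coindLift_apply_apply, hΓ x, inv_one, map_one]
      rfl))

/-- **`Ext^{q+1}_{C_Γ}(N, M) = 0` over a trivial group when the vectors of `M` form an injective `k`-module.**
[cite: SerreGaloisCohomology1997, I §2.5][cite: MilneADT2006, I §0 Example 0.8] -/
theorem ext_succ_eq_zero_of_forall_eq_one (hΓ : ∀ g : Γ, g = 1) (N M : DiscreteRepCat k Γ)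
    [Injective (ModuleCat.of k M.obj.V)] (q : ℕ) (x : Ext N M (q + 1)) : x = 0 :=
  ext_eq_zero_of_iso_coind_of_injective N (isoCoindOfForallEqOne hΓ M) q x

end DiscreteRep

end Literature.Algebra.Homology

/-! ## §2 `Ext^{q+1}_{C_{Γ_{K_u}}}(N, K̄_uˣ) = 0` at a complex place -/

namespace Literature.NumberTheory.GaloisRepresentations

namespace IdeleReadout

open NumberField IsDedekindDomain Field CategoryTheory CategoryTheory.Limits CategoryTheory.Abelian
open Literature.Algebra.Homology Literature.Algebra.Homology.DiscreteRep DiscreteGaloisModule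
open Literature.NumberTheory.GaloisCohomology (eq_one_absoluteGaloisGroup_of_isComplex)

variable {K : Type} [Field K] [NumberField K]

/-- `K̄_Lˣ` (`UnitsCarrier L`) is an injective `ℤ`-module, for the `ℤ`-module structure carried by the object `unitsD L`
(divisible: `divisibleByUnitsCarrier`). [cite: SerreGaloisCohomology1997, II §1.1][cite: MilneADT2006, I §0 Example 0.8] -/
theorem injective_moduleCat_unitsD (L : Type) [Field L] : Injective (ModuleCat.of ℤ (unitsD L).obj.V) :=
  letI : DivisibleBy (UnitsCarrier L) ℤ := divisibleByUnitsCarrier L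
  injective_moduleCat_int_of_divisibleBy (UnitsCarrier L)

/-- **`Ext^{q+1}_{C_{Γ_{K_u}}}(N, K̄_uˣ) = 0` at a COMPLEX place `u`** (`Γ_{K_u}` trivial, `K̄_uˣ` injective over `ℤ`).
[cite: SerreGaloisCohomology1997, I §2.5 and II §6.3][cite: MilneADT2006, I Thm. 4.10 (a)] -/
theorem ext_unitsD_succ_eq_zero_of_isComplex {u : InfinitePlace K} (hu : u.IsComplex)
    (N : DiscreteRepCat ℤ (absoluteGaloisGroup (Place.Completion (Sum.inl u : Place K)))) (q : ℕ)
    (x : Ext N (unitsD (Place.Completion (Sum.inl u : Place K))) (q + 1)) : x = 0 :=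
  haveI : CompactSpace (absoluteGaloisGroup (Place.Completion (Sum.inl u : Place K))) :=
    absoluteGaloisGroup_compactSpace _
  haveI := injective_moduleCat_unitsD (Place.Completion (Sum.inl u : Place K))
  ext_succ_eq_zero_of_forall_eq_one (eq_one_absoluteGaloisGroup_of_isComplex hu) N _ q x

/-! ## §3 The archimedean components of `idLocMap` vanish in positive degree (`K` totally complex) -/

variable (K) (S : Finset (HeightOneSpectrum (𝓞 K)))

/-- **For `K` totally complex, the component of `idLocMap K S A (q+1) z` at an infinite place is `0`.**
[cite: MilneADT2006, I Thm. 4.10 (a) and Lemma 4.13][cite: SerreGaloisCohomology1997, II §6.3] -/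
theorem idLocMap_succ_inl_eq_zero [IsTotallyComplex K]
    (A : DiscreteRepCat ℤ (GaloisGroupUnramifiedOutside K (↑S : Set (HeightOneSpectrum (𝓞 K))))) (q : ℕ)
    (z : Ext A (IdeleClassBar.truncIdeleBarD K S) (q + 1)) (u : InfinitePlace K) :
    idLocMap K S A (q + 1) z ⟨Sum.inl u, trivial⟩ = 0 :=
  ext_unitsD_succ_eq_zero_of_isComplex (IsTotallyComplex.isComplex u) _ q _

/-- **`harch0`** (binder of -w7 g13's `hΛ2_lambdaLoc_of_idLocMap_injective`, degree `2`): for `K` totally complex,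
`∀ z (u : InfinitePlace K), idLocMap K S A 2 z ⟨Sum.inl u, trivial⟩ = 0`. [cite: MilneADT2006, I Thm. 4.10 (a) and Lemma 4.13]
[cite: SerreGaloisCohomology1997, II §6.3] -/
theorem idLocMap_two_inl_eq_zero [IsTotallyComplex K]
    (A : DiscreteRepCat ℤ (GaloisGroupUnramifiedOutside K (↑S : Set (HeightOneSpectrum (𝓞 K))))) :
    ∀ (z : Ext A (IdeleClassBar.truncIdeleBarD K S) 2) (u : InfinitePlace K),
      idLocMap K S A 2 z ⟨Sum.inl u, trivial⟩ = 0 :=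
  fun z u => idLocMap_succ_inl_eq_zero K S A 1 z u

end IdeleReadout

end Literature.NumberTheory.GaloisRepresentations

end
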